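import Summits.QuantumAdvantage.QuantumAdvantage.Theorems.CubicForrelationNearExactIsExactFourteenLevelSixPrep

/-!
# Crux `CubicForrelation.NearExactIsExact` (stmt-QuantumAdvantage-14043) — n = 14, TWO-SIDED: no pair with BOTH Walsh spectra of
  type O reaches `Φ = 31/32`

Certificate seat `b2b-cforr-cert` (gen 4).  HONEST FRAMING: a theorem about cubic Boolean functions on 14 bits (the finite slice `n = 14`
of the crux) — NOT summit progress.

Setting: `f, g : 𝔽₂¹⁴ → 𝔽₂` cubic, `W_g = 32·u_g`, `W_f = 32·u_f` (Ax), both of TYPE O (all `u` odd).  `ft_typeO_pair_false`: then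
`Φ(f,g) ≥ 31/32` is impossible.  Proof (two-sided throughout):
* BUDGET (`fl_budget5`): `Σ_x (u_g − 4(−1)^f)² = 2¹⁹(1 − Φ) ≤ 2¹⁴`, every term is an odd square, so `τ_g := u_g − 4(−1)^f = ±1`
  EVERYWHERE; by symmetry `τ_f := u_f − 4(−1)^g = ±1` everywhere.
* DIGIT: `τ_g = (−1)^{d₁}` with `d₁ = [⌊u_g/2⌋ odd]` QUADRATIC (`fd_digitOne`).
* FOURIER: Walsh inversion (`Σ_x u_g(x)(−1)^{x·y} = 512(−1)^{g(y)}`) and `4W_f = 128 u_f = 512(−1)^g + 128 τ_f` give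
  `W_{d₁}(y) = −128·τ_f(y) ≠ 0` for every `y`: the quadratic `d₁` is BENT.
* SYMPLECTIC EXTRACTION (`es_extract`, `es_flat_signsum`): a bent quadratic has a parametrised 4-flat on which its sign sum is `±4`;
  but GENERAL FLAT SUMS (`fs_flat_sum_dvd`, `k = 4`: `Σ_ε u_g(x ⊕ a_ε) ≡ 0 (mod 8)`, and `4·Σ_ε (−1)^f ≡ 0 (mod 8)`) force every
  parametrised 4-flat sign sum of `τ_g` to be `≡ 0 (mod 8)`. Contradiction.
With `…FourteenLevelSix.lean` (level 6) and the tower (level 7 / bent) this closes the boundary: `Φ ≥ 31/32 ⇒ Φ = 1` on 14 bits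
(`…FourteenBoundary.lean`).

References: J. Ax (1964) / R. J. McEliece (1972) (Carlet 2021 §4.1); L. E. Dickson (1901) / MacWilliams–Sloane (1977) Ch. 15 (symplectic
normal form); S. Aaronson, A. Ambainis, SIAM J. Comput. 47 (2018) §1.1.1.  Everything below is proved from Mathlib and the tree; axioms are
the standard three.
-/

set_option linter.dupNamespace false -- D-0017: single-problem summit ⇒ `QuantumAdvantage.QuantumAdvantage` by design

noncomputable section

namespace Summit.QuantumAdvantage.QuantumAdvantage.Theorems.CubicForrelation.NearExactIsExact

open Finset
open Literature.Computability.QuantumComplexity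
open Literature.Computability.QuantumComplexity.BuzetChailloux (bxor zeroVec bxor_bxor_cancel_left bxor_zeroVec zeroVec_bxor bxor_comm
  signOf_sq)
open Literature.Computability.QuantumComplexity.DerivativeWalsh (W sum_W_sq twist_bxor_left)
open Summit.QuantumAdvantage.QuantumAdvantage.Theorems.SignedCubicForrelationNotPrBPP.Negative.HalfQuad (forrelation_comm)

/-- An odd integer minus a multiple of `4` of a sign has square `≥ 1`. [folklore] -/
theorem ft_sq_ge_one {a s : ℤ} (hs : s = 1 ∨ s = -1) (ha : Odd a) : 1 ≤ (a - 4 * s) ^ 2 := by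
  have h1 := Int.odd_iff.1 ha
  have key : a - 4 * s ≤ -1 ∨ 1 ≤ a - 4 * s := by rcases hs with hs | hs <;> rw [hs] <;> omega
  have := tp_sq_ge (k := 1) (by norm_num) key
  simpa using this

/-- **Type-O rigidity at the boundary.** For cubic `f, g` on 14 bits with `W_g = 32u`, all `u` odd and `Φ(f,g) ≥ 31/32`, the residual
`u − 4(−1)^f` is `±1` at EVERY point (the budget `2¹⁹(1−Φ) ≤ 2¹⁴` is spent at one unit per point). [this work] -/
theorem ft_residual_pm_one (f g : (Fin (7 + 7) → Bool) → Bool) (u : (Fin (7 + 7) → Bool) → ℤ)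
    (hu : ∀ x, W (fun y => signOf (g y)) x = (2 : ℝ) ^ 5 * (u x : ℝ)) (hodd : ∀ x, Odd (u x))
    (hΦ : (31 / 32 : ℝ) ≤ forrelation f g) : ∀ x, u x - 4 * sZ (f x) = 1 ∨ u x - 4 * sZ (f x) = -1 := by
  have hB : (∑ x, (u x - 4 * sZ (f x)) ^ 2 : ℤ) ≤ 16384 := by
    have h := fl_budget5 f g u hu
    have h' : ((∑ x, (u x - 4 * sZ (f x)) ^ 2 : ℤ) : ℝ) ≤ 16384 := by rw [h]; nlinarith
    exact_mod_cast h'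
  have hnonneg : ∀ x, 0 ≤ (u x - 4 * sZ (f x)) ^ 2 - 1 := fun x => by
    have := ft_sq_ge_one (tp_sZ_cases (f x)) (hodd x); linarith
  have hsum0 : ∑ x, ((u x - 4 * sZ (f x)) ^ 2 - 1 : ℤ) = 0 := by
    refine le_antisymm ?_ (sum_nonneg fun x _ => hnonneg x)
    rw [sum_sub_distrib, sum_const, card_univ, Fintype.card_fun, Fintype.card_bool, Fintype.card_fin]
    norm_num
    linarith
  intro x
  have h := (sum_eq_zero_iff_of_nonneg fun y _ => hnonneg y).1 hsum0 x (mem_univ x)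
  have h1 : (u x - 4 * sZ (f x)) * (u x - 4 * sZ (f x)) = 1 := by rw [← pow_two]; linarith
  exact mul_self_eq_one_iff.1 h1

/-- **No type-O/type-O pair at the boundary.** For cubic `f, g : 𝔽₂¹⁴ → 𝔽₂` whose Walsh spectra are both `32·(odd)` everywhere,
`Φ(f,g) ≥ 31/32` is impossible: the digit `d₁ = [⌊u_g/2⌋ odd]` would be a bent quadratic all of whose parametrised 4-flat sign sums
are `≡ 0 (mod 8)`, against symplectic extraction (`±4`). [this work] -/
theorem ft_typeO_pair_false (f g : (Fin (7 + 7) → Bool) → Bool) (hg : IsDegLeFun 3 g)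
    (ug : (Fin (7 + 7) → Bool) → ℤ) (hug : ∀ x, W (fun y => signOf (g y)) x = (2 : ℝ) ^ 5 * (ug x : ℝ))
    (uf : (Fin (7 + 7) → Bool) → ℤ) (huf : ∀ x, W (fun y => signOf (f y)) x = (2 : ℝ) ^ 5 * (uf x : ℝ))
    (hog : ∀ x, Odd (ug x)) (hof : ∀ x, Odd (uf x)) (hΦ : (31 / 32 : ℝ) ≤ forrelation f g) : False := by
  classical
  -- (1) the residuals are `±1` everywhere, on both sides
  have hτg := ft_residual_pm_one f g ug hug hog hΦ
  have hΦ' : (31 / 32 : ℝ) ≤ forrelation g f := by rw [forrelation_comm]; exact hΦ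
  have hτf := ft_residual_pm_one g f uf huf hof hΦ'
  -- (2) the residual of `g` is the sign of the quadratic digit `d₁`
  have hd₁ : IsDegLeFun 2 (fun x => decide (Odd (ug x / 2))) := fd_digitOne g ug hg hug
  have hτeq : ∀ x, ug x - 4 * sZ (f x) = sZ (decide (Odd (ug x / 2))) := by
    intro x
    rcases hτg x with h | h
    · have hu : ug x / 2 = 2 * sZ (f x) := by omega
      have hev : ¬ Odd (ug x / 2) := by rw [hu, Int.not_odd_iff_even]; exact even_two_mul _
      rw [h, decide_eq_false hev]; rfl
    · have hu : ug x / 2 = 2 * sZ (f x) - 1 := by omega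
      have hod : Odd (ug x / 2) := by rw [hu]; exact ⟨sZ (f x) - 1, by ring⟩
      rw [h, decide_eq_true hod]; rfl
  -- (3) Fourier: `W_{d₁}(y) = −128·τ_f(y) ≠ 0`
  have hinv : ∀ y, ∑ x, (ug x : ℝ) * twist x y = 512 * signOf (g y) := by
    intro y
    have h := tz_inversion (fun z => signOf (g z)) y
    rw [sum_congr rfl fun x _ => by rw [hug x]] at h
    have e : ∑ x, (2 : ℝ) ^ 5 * (ug x : ℝ) * twist x y = 2 ^ 5 * ∑ x, (ug x : ℝ) * twist x y := by
      rw [mul_sum]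
      exact sum_congr rfl fun x _ => by ring
    rw [e] at h
    have h' : (2 : ℝ) ^ 5 * (∑ x, (ug x : ℝ) * twist x y - 512 * signOf (g y)) = 0 := by
      rw [mul_sub, h]; norm_num; ring
    have h2 : (2 : ℝ) ^ 5 ≠ 0 := by positivity
    linarith [(mul_eq_zero.1 h').resolve_left h2]
  have hWd : ∀ y, W (fun x => signOf (decide (Odd (ug x / 2)))) y = -128 * (((uf y - 4 * sZ (g y) : ℤ)) : ℝ) := by
    intro y
    unfold W
    have e : ∀ x, signOf (decide (Odd (ug x / 2))) * twist x y = (ug x : ℝ) * twist x y - 4 * (signOf (f x) * twist x y) := by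
      intro x
      rw [← tp_sZ_cast, ← hτeq x, ← tp_sZ_cast]
      push_cast
      ring
    rw [sum_congr rfl fun x _ => e x, sum_sub_distrib, ← mul_sum, hinv y]
    have hWf : ∑ x, signOf (f x) * twist x y = (2 : ℝ) ^ 5 * (uf y : ℝ) := huf y
    rw [hWf]
    push_cast
    rw [tp_sZ_cast]
    ring
  have hW : ∀ y, W (fun x => signOf (decide (Odd (ug x / 2)))) y ≠ 0 := by
    intro y
    rw [hWd y]
    rcases hτf y with h | h <;> rw [h] <;> norm_num
  -- (4) symplectic extraction: a parametrised 4-flat with sign sum `±4`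
  obtain ⟨a₀, a₁, a₂, a₃, h01, h23, h02, h03, h12, h13⟩ := es_extract (by norm_num : 3 ≤ 7 + 7) _ hd₁ hW
  have hsig := es_flat_signsum _ hd₁ a₀ a₁ a₂ a₃ h01 h23 h02 h03 h12 h13 zeroVec
  -- (5) but general flat sums make every such sum `≡ 0 (mod 8)`
  have h8 := fs_flat_sum_dvd (e := 3) g ug hg hug zeroVec ![a₀, a₁, a₂, a₃] (by norm_num)
  have hsf : (8 : ℤ) ∣ ∑ ε : Fin 4 → Bool, 4 * sZ (f (fun j => zeroVec j ^^
      decide (Odd #(univ.filter fun i : Fin 4 => ε i && (![a₀, a₁, a₂, a₃] : Fin 4 → Fin (7 + 7) → Bool) i j)))) := by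
    have e1 : ∀ b : Bool, 4 * sZ b = 4 - 8 * (if b then 1 else 0 : ℤ) := by intro b; cases b <;> simp [sZ]
    simp_rw [e1]
    rw [sum_sub_distrib, sum_const, card_univ, Fintype.card_fun, Fintype.card_bool, Fintype.card_fin, ← mul_sum]
    exact ⟨8 - ∑ ε : Fin 4 → Bool, (if f (fun j => zeroVec j ^^
      decide (Odd #(univ.filter fun i : Fin 4 => ε i && (![a₀, a₁, a₂, a₃] : Fin 4 → Fin (7 + 7) → Bool) i j))) then 1 else 0 : ℤ),
      by norm_num; ring⟩
  have hτ8 : (8 : ℤ) ∣ ∑ ε : Fin 4 → Bool, sZ (decide (Odd (ug (fun j => zeroVec j ^^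
      decide (Odd #(univ.filter fun i : Fin 4 => ε i && (![a₀, a₁, a₂, a₃] : Fin 4 → Fin (7 + 7) → Bool) i j))) / 2))) := by
    rw [← sum_congr rfl fun ε _ => hτeq _, sum_sub_distrib]
    exact dvd_sub h8 hsf
  have hcast : ((∑ ε : Fin 4 → Bool, sZ (decide (Odd (ug (fun j => zeroVec j ^^
      decide (Odd #(univ.filter fun i : Fin 4 => ε i && (![a₀, a₁, a₂, a₃] : Fin 4 → Fin (7 + 7) → Bool) i j))) / 2))) : ℤ) : ℝ) =
      ∑ ε : Fin 4 → Bool, signOf (decide (Odd (ug (fun j => zeroVec j ^^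
        decide (Odd #(univ.filter fun i : Fin 4 => ε i && (![a₀, a₁, a₂, a₃] : Fin 4 → Fin (7 + 7) → Bool) i j))) / 2))) := by
    push_cast
    exact sum_congr rfl fun ε _ => tp_sZ_cast _
  rcases hsig with h | h
  · have h4 : (∑ ε : Fin 4 → Bool, sZ (decide (Odd (ug (fun j => zeroVec j ^^
        decide (Odd #(univ.filter fun i : Fin 4 => ε i && (![a₀, a₁, a₂, a₃] : Fin 4 → Fin (7 + 7) → Bool) i j))) / 2))) : ℤ) = 4 := by
      have : ((∑ ε : Fin 4 → Bool, sZ (decide (Odd (ug (fun j => zeroVec j ^^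
        decide (Odd #(univ.filter fun i : Fin 4 => ε i && (![a₀, a₁, a₂, a₃] : Fin 4 → Fin (7 + 7) → Bool) i j))) / 2))) : ℤ) : ℝ)
          = ((4 : ℤ) : ℝ) := by rw [hcast, h]; norm_num
      exact_mod_cast this
    rw [h4] at hτ8
    omega
  · have h4 : (∑ ε : Fin 4 → Bool, sZ (decide (Odd (ug (fun j => zeroVec j ^^
        decide (Odd #(univ.filter fun i : Fin 4 => ε i && (![a₀, a₁, a₂, a₃] : Fin 4 → Fin (7 + 7) → Bool) i j))) / 2))) : ℤ) = -4 := by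
      have : ((∑ ε : Fin 4 → Bool, sZ (decide (Odd (ug (fun j => zeroVec j ^^
        decide (Odd #(univ.filter fun i : Fin 4 => ε i && (![a₀, a₁, a₂, a₃] : Fin 4 → Fin (7 + 7) → Bool) i j))) / 2))) : ℤ) : ℝ)
          = ((-4 : ℤ) : ℝ) := by rw [hcast, h]; norm_num
      exact_mod_cast this
    rw [h4] at hτ8
    omega

end Summit.QuantumAdvantage.QuantumAdvantage.Theorems.CubicForrelation.NearExactIsExact

end
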